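import Mathlib.Tactic
import HarnessLib

/-!
# Kozma–Nitzan's Question 8 — UNI-C(U;y): the out-defect identity `Φπ − c = π² + m(Φ−π)/Φ` and the coverage step of THEOREM W (gen 38, part 2)

Support file (`--supports stmt-CriticalPhenomena-4575`, closed crux; independent mathematics on Kozma–Nitzan's Question 8,
arXiv:2401.12397 §5.5 p. 36), prover `prim-ineq-gen-6` (gen 38).  No definitions, no named facts, no sorries; standard axioms.
Memo `run/shared/lean/prim/prim-ineq-gen-6/PROOF-UNIC-LP-G38.md` (§2 PROPOSITION D, THEOREM W); companion of …KnQuestion8UniCLP.lean.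

* `kLP_phipi`: with `D = Φ − π` (the A-alive C-defect mass; `ε + π − m = Φ` because `M = A + C − AC`) and `cΦ = D(πΦ − m)`,
  the kill coefficient's main constant is `Φπ − c = π² + m(Φ−π)/Φ ≥ π²` — it does not degenerate with the budget `B = Φ²m/(Φ+m)`.
* `kLP_coverW`: the coverage step of the uniform joint multiplier of THEOREM W / the schema: if
  `Ω ≥ C·Φ·max(a·fa·m, (1−α)·u)` (the two lower bounds (Ω1)/(Ω2)+(D2) of the canonical joint weight) and
  `y·Φ·(a·fa·μ' + μ(1−α)u) ≥ (1+μ)·γ·fa` with `μ' = max(m, μ)`, then `y·Ω ≥ γ·C·fa·min(1, m/μ)`.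
* `kLP_ushare`: the budget's A-defect mass against the same denominator: `(α + (1−α)u)/(α·m + μ(1−α)u)·... ≤ (1+μ)/μ`-type step,
  in the product form `μ(α + (1−α)u) ≤ (α·μ' + μ(1−α)u)` for `μ ≤ μ' ` and `μ ≤ 1`.
[cite: KozmaNitzan2024, Question 8 (§5.5 p. 36)]
-/

namespace Summit.CriticalPhenomena.PercolationContinuityZ3.Theorems

namespace PocketCert

/-- **The out-defect identity.**  `D = Φ − π`, `cΦ = D(πΦ − m)`, `Φ > 0` give `(Φπ − c)Φ = π²Φ + m(Φ − π)`; with `π ≤ Φ` and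
`m ≥ 0` hence `Φπ − c ≥ π²`.
[cite: KozmaNitzan2024, Question 8 (§5.5 p. 36)] -/
theorem kLP_phipi (Φ π m c D : ℝ) (hΦ : 0 < Φ) (hD : D = Φ - π) (hc : c * Φ = D * (π * Φ - m))
    (hπ : π ≤ Φ) (hm : 0 ≤ m) :
    (Φ * π - c) * Φ = π ^ 2 * Φ + m * (Φ - π) ∧ π ^ 2 ≤ Φ * π - c := by
  have e1 : (Φ * π - c) * Φ = π ^ 2 * Φ + m * (Φ - π) := by
    have : c * Φ = (Φ - π) * (π * Φ - m) := by rw [hc, hD]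
    nlinarith
  refine ⟨e1, ?_⟩
  have h2 : 0 ≤ m * (Φ - π) := mul_nonneg hm (by linarith)
  -- (Φπ − c)Φ ≥ π²Φ, divide by Φ > 0
  have h3 : π ^ 2 * Φ ≤ (Φ * π - c) * Φ := by linarith
  exact le_of_mul_le_mul_right h3 hΦ

/-- **Budget mass against the coverage denominator.**  For `μ ≤ μ'`, `0 ≤ α`:
`μ·(α + (1−α)u) ≤ α·μ' + μ·(1−α)·u`.  (The A-defect mass `ǔ_{k₁} ≤ α + (1−α)u` of the budget is at most `1/μ` times the
denominator of the joint multiplier.)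
[cite: KozmaNitzan2024, Question 8 (§5.5 p. 36)] -/
theorem kLP_ushare (μ μ' α u : ℝ) (hμ' : μ ≤ μ') (hα0 : 0 ≤ α) :
    μ * (α + (1 - α) * u) ≤ α * μ' + μ * ((1 - α) * u) := by
  have h1 : μ * α ≤ α * μ' := by nlinarith
  nlinarith

/-- **Coverage step of THEOREM W / the schema.**  If the canonical joint weight satisfies the two lower bounds
`Ω ≥ C·Φ·(a·fa·m)` and `Ω ≥ C·Φ·((1−α)·u)`, and the multiplier `y ≥ 0` satisfies `y·Φ·(a·fa·μ' + μ·(1−α)·u) ≥ (1+μ)·γ·fa` with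
`0 < μ` and the share encoded as `σ ∈ [0,1]` with `σ·μ' ≤ m` (`σ = min(1, m/μ)` for `μ' = max(m, μ)`), then `y·Ω ≥ σ·γ·C·fa`.
[cite: KozmaNitzan2024, Question 8 (§5.5 p. 36)] -/
theorem kLP_coverW (Ω C Φ a fa m α u y μ μ' γ σ : ℝ)
    (hC : 0 ≤ C) (hΦ : 0 ≤ Φ) (ha : 0 ≤ a) (hfa : 0 ≤ fa) (hα1 : α ≤ 1) (hu : 0 ≤ u) (hy : 0 ≤ y)
    (hμ : 0 < μ) (hσ0 : 0 ≤ σ) (hσ1 : σ ≤ 1) (hσm : σ * μ' ≤ m)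
    (hΩ1 : C * Φ * (a * fa * m) ≤ Ω) (hΩ2 : C * Φ * ((1 - α) * u) ≤ Ω)
    (hyc : (1 + μ) * γ * fa ≤ y * Φ * (a * fa * μ' + μ * ((1 - α) * u))) :
    σ * γ * C * fa ≤ y * Ω := by
  -- Ω ≥ CΦ·(λ₁·a fa m + (1−λ₁)(1−α)u) for λ₁ = 1/(1+μ):  (1+μ)Ω ≥ CΦ(a fa m + μ(1−α)u)
  have hmu0 : 0 ≤ μ := hμ.le
  have h1 : (1 + μ) * Ω ≥ C * Φ * (a * fa * m + μ * ((1 - α) * u)) := by nlinarith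
  -- σ·(a fa μ' + μ(1−α)u) ≤ a fa m + μ(1−α)u   (σ μ' ≤ m, σ ≤ 1)
  have h2 : σ * (a * fa * μ' + μ * ((1 - α) * u)) ≤ a * fa * m + μ * ((1 - α) * u) := by
    have h21 : σ * (a * fa * μ') ≤ a * fa * m := by
      have : a * fa * (σ * μ') ≤ a * fa * m := mul_le_mul_of_nonneg_left hσm (mul_nonneg ha hfa)
      nlinarith
    have h22 : σ * (μ * ((1 - α) * u)) ≤ μ * ((1 - α) * u) := by
      have h0 : 0 ≤ μ * ((1 - α) * u) := mul_nonneg hmu0 (mul_nonneg (by linarith) hu)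
      nlinarith
    nlinarith
  -- chain: σ γ C fa (1+μ) ≤ σ · y Φ (…) · C ≤ y · CΦ(a fa m + μ(1−α)u) ≤ y (1+μ) Ω
  have h3 : σ * ((1 + μ) * γ * fa) ≤ σ * (y * Φ * (a * fa * μ' + μ * ((1 - α) * u))) :=
    mul_le_mul_of_nonneg_left hyc hσ0
  have h4 : σ * (y * Φ * (a * fa * μ' + μ * ((1 - α) * u))) = y * Φ * (σ * (a * fa * μ' + μ * ((1 - α) * u))) := by ring
  have h5 : y * Φ * (σ * (a * fa * μ' + μ * ((1 - α) * u))) ≤ y * Φ * (a * fa * m + μ * ((1 - α) * u)) :=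
    mul_le_mul_of_nonneg_left h2 (mul_nonneg hy hΦ)
  have h6 : C * (y * Φ * (a * fa * m + μ * ((1 - α) * u))) = y * (C * Φ * (a * fa * m + μ * ((1 - α) * u))) := by ring
  have h7 : y * (C * Φ * (a * fa * m + μ * ((1 - α) * u))) ≤ y * ((1 + μ) * Ω) :=
    mul_le_mul_of_nonneg_left (by linarith [h1]) hy
  -- assemble: C σ (1+μ) γ fa ≤ C·[σ y Φ (…)] ≤ C y Φ (a fa m + …) ≤ y (1+μ) Ω
  have h8 : C * (σ * ((1 + μ) * γ * fa)) ≤ C * (σ * (y * Φ * (a * fa * μ' + μ * ((1 - α) * u)))) :=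
    mul_le_mul_of_nonneg_left h3 hC
  have h9 : C * (σ * (y * Φ * (a * fa * μ' + μ * ((1 - α) * u)))) ≤ C * (y * Φ * (a * fa * m + μ * ((1 - α) * u))) := by
    rw [h4]; exact mul_le_mul_of_nonneg_left h5 hC
  have h10 : C * (σ * ((1 + μ) * γ * fa)) ≤ y * ((1 + μ) * Ω) := by linarith [h8, h9, h6, h7]
  -- divide by (1+μ) > 0
  have h11 : (1 + μ) * (σ * γ * C * fa) ≤ (1 + μ) * (y * Ω) := by nlinarith [h10]
  exact le_of_mul_le_mul_left h11 (by linarith)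

end PocketCert

end Summit.CriticalPhenomena.PercolationContinuityZ3.Theorems
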